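import Summits.QuantumFields.BalabanUV.Beta.BondIndicatorGaugeL1
import Summits.QuantumFields.BalabanUV.Beta.DshAn1Spread

/-!
# `BalabanUV.Beta.D1BFx.DshBlockMass` — road «BF-x», binder row D1 (pricing letters for the `Dsh`-words of PART 24 HEAD (b), MASS currency — OWNER d1-p2 g25 DESIGN NOTE
# N-g25-1 (1): «`Dsh` — block mass `≤ (d+1)·n^{d+2} = 4n⁵`»): **THE TWO BLOCK MASSES OF THE FIELD–MULTIPLIER BLOCK OF an1's BORDER SHIFT `Dsh N` AT A COARSE POINT** —
# `Σ_α Σ_{b′ ∈ box} |Dsh N (N•Y + b′) (N•Y) (inl α) (inr m)| ≤ N^{d+1}·((d+1)·N)` (own block `B(Y)`) and `Σ_α Σ_{b′ ∈ box} |Dsh N (N•(Y + e_m) + b′) (N•Y) (inl α) (inr m)| ≤ N^{d+1}·((d+1)·N)`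
# (the neighbouring block `B(Y + e_m)`; every other block reads `0`) — gan24-leaf-05 g58's block-ℓ¹ law of an1's comb weights `BondIndicatorGaugeL1.sum_univ_box_abs_lam04_le`
# (`Σ_κ Σ_{b ∈ box} |lam04 N κ (N•y′ + b) Y| ≤ N^{d+1}·((d+1)·N)`) BY NAME, composed with an1's (Dgrad) `Dsh_inl_inr` and the one-point support `DshAn1Spread.lam04_eq_zero_of_ne_blk`.
# This is the MASS twin of the SUP letter `D1BFx/DshEntrySharp.abs_Dsh_le_pow` (`N^{d+1}` per entry): an1's `cDsh d N = 2N^{d+1}(d+1)N` is, up to the factor 2, this block mass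
# (leaf-01 g32 located count, memo `HOME/b2b-balaban-beta-d1-formalise-leaf-01/g32/LOCATED-COUNT-DshWords-g32.md` §3).

HONEST DEPENDENCY (cell records, verbatim): «continuum YM on T⁴ ⇐ BetaPertH ∧ nine spine estimates (0/9 proved); BetaPertH ⇐ (D1) ∧ (D4) ∧
CAP+tail; G-an2-4 gates asym, D1 and NE2/3/4.»  HONEST FRAMING (cell contract, verbatim): «discharging `BetaPertH` makes Bałaban's UV stability
UNCONDITIONAL — a real constructive-QFT result; it is NOT the continuum limit and NOT the Clay problem.»  THIS MODULE is [folklore] bookkeeping over gan24-leaf-05's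
`BondIndicatorGaugeL1` and an1's `DshAn1 ∕ DshAn1Spread` BY NAME; it is a MASS LETTER, it prices NO (1.22) row and changes no identity.  No `def`, no `def … : Prop`,
nothing cited, NO printed hypothesis, 0 sorry.  0 root-level binders of row D1 discharged; (K) NOT closed; (J1) ONE OPEN ROW; NOT D1, NEVER «G-an2-4 closed»,
NOT `BetaPertH`, NOT continuum, NOT Clay.  (RESHAPED from the draft v0 40461cb6d77a2d57, whose §1–§2 comb lemmas were ALREADY IN THE TREE as `BondIndicatorGaugeL1` §1–§3 —
gan24-leaf-05 g58, 2026-08-23 — and are therefore imported, not restated.)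

ABSOLUTE RULE (cell charter, verbatim): «No internally-minted statement may enter as a cited fact. Every hypothesis is either kernel-proved in
this package or a verbatim quotation of a PUBLISHED theorem with page reference. The manuscript(s) under audit are NOT citable for their own
disputed steps — they are the thing under adjudication; programme-internal (2001/route/tribunal) claims are never citable.»

CONTENT.  `abs_Dsh_inl_inr_le_add` (`|Dsh N x (N•Y) (inl α) (inr m)| ≤ |lam04 N α x (Y + e_m)| + |lam04 N α x Y|`), **`sum_abs_Dsh_block_le`** (own block),
**`sum_abs_Dsh_block_succ_le`** (neighbouring block), `Dsh_inl_inr_eq_zero_of_blk_ne` (every other block reads `0`).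
Unit `b2b-balaban-beta-d1-formalise-leaf-01` (gen 32), D1 formalisation swarm LEAF PROVER 01, road «BF-x»; OFFER O-6.  Not in print; our bookkeeping.  No existing file touched.
-/

noncomputable section

namespace Summit.QuantumFields.BalabanUV.Beta.D1BFx.DshBlockMass

open Finset
open scoped BigOperators
open Literature.MathematicalPhysics.QuantumFieldTheory
open Literature.MathematicalPhysics.QuantumFieldTheory.Balaban1983to89
open Literature.MathematicalPhysics.QuantumFieldTheory.Balaban1983to89.Beta
open AffineAveraging (unitVec unitVec_apply dz box toSite)
open AveragingContours (blk blk_block)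
open OneStepResolventKernel (Fib quo_zsmul proj_zsmul)
open Summit.QuantumFields.BalabanUV.Beta.DshAn1 (lam04 Dsh Dsh_inl_inr lam04_eq_zero_of_ne_blk)
open Summit.QuantumFields.BalabanUV.Beta.BondIndicatorGaugeL1 (sum_univ_box_abs_lam04_le)

variable {d : ℕ}

/-- [folklore] The field–multiplier entry of `Dsh` at a coarse point is the difference of two readings of the one-block potential:
`|Dsh N x (N•Y) (inl α) (inr m)| ≤ |lam04 N α x (Y + e_m)| + |lam04 N α x Y|` (an1's (Dgrad) `Dsh_inl_inr`). -/
theorem abs_Dsh_inl_inr_le_add {N : ℕ} [NeZero N] (x Y : Fin (d + 1) → ℤ) (α m : Fin (d + 1)) :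
    |Dsh N x ((N : ℤ) • Y) (Sum.inl α) (Sum.inr m)| ≤ |lam04 N α x (Y + unitVec m)| + |lam04 N α x Y| := by
  rw [Dsh_inl_inr, if_pos (proj_zsmul Y), quo_zsmul, dz]
  exact abs_sub _ _

/-- [folklore] **THE BLOCK MASS OF `Dsh`'s FIELD–MULTIPLIER BLOCK, OWN BLOCK**: at the coarse point `N•Y`, direction `m`, the fine bonds of the block `B(Y)` carry
`Σ_α Σ_{b′ ∈ box} |Dsh N (N•Y + toSite b′) (N•Y) (inl α) (inr m)| ≤ N^{d+1}·((d+1)·N)` (on `B(Y)` the reading at `Y + e_m` vanishes — one-point support — and the reading at `Y`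
is gan24-leaf-05's block-ℓ¹ law `sum_univ_box_abs_lam04_le`). -/
theorem sum_abs_Dsh_block_le {N : ℕ} [NeZero N] (hN : 1 ≤ N) (Y : Fin (d + 1) → ℤ) (m : Fin (d + 1)) :
    ∑ α : Fin (d + 1), ∑ b' ∈ box (d + 1) N, |Dsh N ((N : ℤ) • Y + toSite b') ((N : ℤ) • Y) (Sum.inl α) (Sum.inr m)|
      ≤ (N : ℝ) ^ (d + 1) * (((d : ℝ) + 1) * N) := by
  refine (Finset.sum_le_sum fun α _ => Finset.sum_le_sum fun b' hb' => ?_).trans (sum_univ_box_abs_lam04_le hN Y Y)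
  refine (abs_Dsh_inl_inr_le_add _ Y α m).trans (le_of_eq ?_)
  have hne : Y + unitVec m ≠ blk N ((N : ℤ) • Y + toSite b') := by
    rw [blk_block Y hb']; intro h
    have := congrFun h m
    simp [unitVec_apply] at this
  rw [lam04_eq_zero_of_ne_blk hN hne, abs_zero, zero_add]

/-- [folklore] **THE BLOCK MASS OF `Dsh`'s FIELD–MULTIPLIER BLOCK, NEIGHBOURING BLOCK**: at the coarse point `N•Y`, direction `m`, the fine bonds of the block
`B(Y + e_m)` carry `Σ_α Σ_{b′ ∈ box} |Dsh N (N•(Y + e_m) + toSite b′) (N•Y) (inl α) (inr m)| ≤ N^{d+1}·((d+1)·N)` (there the reading at `Y` vanishes). -/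
theorem sum_abs_Dsh_block_succ_le {N : ℕ} [NeZero N] (hN : 1 ≤ N) (Y : Fin (d + 1) → ℤ) (m : Fin (d + 1)) :
    ∑ α : Fin (d + 1), ∑ b' ∈ box (d + 1) N, |Dsh N ((N : ℤ) • (Y + unitVec m) + toSite b') ((N : ℤ) • Y) (Sum.inl α) (Sum.inr m)|
      ≤ (N : ℝ) ^ (d + 1) * (((d : ℝ) + 1) * N) := by
  refine (Finset.sum_le_sum fun α _ => Finset.sum_le_sum fun b' hb' => ?_).trans (sum_univ_box_abs_lam04_le hN (Y + unitVec m) (Y + unitVec m))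
  refine (abs_Dsh_inl_inr_le_add _ Y α m).trans (le_of_eq ?_)
  have hne : Y ≠ blk N ((N : ℤ) • (Y + unitVec m) + toSite b') := by
    rw [blk_block (Y + unitVec m) hb']; intro h
    have := congrFun h m
    simp [unitVec_apply] at this
  rw [lam04_eq_zero_of_ne_blk hN hne, abs_zero, add_zero]

/-- [folklore] **EVERY OTHER BLOCK READS `0`**: if the fine point `x` lies neither in `B(Y)` nor in `B(Y + e_m)`, then `Dsh N x (N•Y) (inl α) (inr m) = 0`
(both readings of the one-block potential vanish). -/
theorem Dsh_inl_inr_eq_zero_of_blk_ne {N : ℕ} [NeZero N] (hN : 1 ≤ N) {x Y : Fin (d + 1) → ℤ} {m : Fin (d + 1)} (h0 : blk N x ≠ Y) (h1 : blk N x ≠ Y + unitVec m)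
    (α : Fin (d + 1)) : Dsh N x ((N : ℤ) • Y) (Sum.inl α) (Sum.inr m) = 0 := by
  rw [Dsh_inl_inr, if_pos (proj_zsmul Y), quo_zsmul, dz, lam04_eq_zero_of_ne_blk hN (Ne.symm h1), lam04_eq_zero_of_ne_blk hN (Ne.symm h0), sub_zero]

end Summit.QuantumFields.BalabanUV.Beta.D1BFx.DshBlockMass

end
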